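import Literature.Probability.Percolation.SelfRefinementMeasure
import Literature.Probability.Percolation.KohlerSchindlerTassionRSW
import Summits.CriticalPhenomena.CardyFormulaZ2.Theorems.CardySelfRefinementCriticalPathRSWStubCone3LocalB

/-!
# Stub `stub_cone3` of line `finite-size-envelope` (crux `CriticalPathRSW`), part 7:
local combinatorics of a tuple, III — atoms force a pivotal interior label along a short walk

Support file for item `stmt-CriticalPhenomena-10267` (stub `stub_cone3`).  Same setting and local
notations as parts I–II.  An **atom** of the (closed) tuple `(b, d)` in the configuration `V` is a
single sub-edge whose opening alone joins the sides of the box.  By the "adding one open edge"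
lemma its two ends are then joined to opposite sides, and a walk of at most four INTERIOR
(non-axial) labels next to the tuple runs from a vertex joined to one side to a vertex joined to the
other; the surgery lemma makes one of its labels pivotal after opening the previous ones.  The three
atoms give `Cone3.atom_u` (sub-edge at `u`), `Cone3.atom_w` (at `w`) and `Cone3.atom_m` (middle
sub-edge); the walks are parametrised by the row `s = 2t + 1 ∈ {1, -1}` next to the tuple.

References: Aizenman–Grimmett 1991 §3 (local modification arguments); Grimmett 1999 §2.4.
-/

noncomputable section

namespace Summit.CriticalPhenomena.CardyFormulaZ2.Cruxes.CriticalPathRSW.FiniteSizeEnvelope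

open Set
open Literature.Probability.LatticeModels Literature.Probability.Percolation

namespace Cone3

variable {M N : ℕ} {b : Site 2} {d d' : Fin 2}

set_option quotPrecheck false

/-- The local frame of the tuple `(b, d)`: `pt⟪α, β⟫ = 3b + α e_d + β e_{d'}`. -/
local notation "pt⟪" α ", " β "⟫" =>
  ((3 : ℤ) • b + (α : ℤ) • (Pi.single d (1 : ℤ) : Site 2) + (β : ℤ) • (Pi.single d' (1 : ℤ) : Site 2))

/-- Neighbours of `a` through an open label of `U`, inside `B`. -/
local notation "nbr⟪" B ", " U ", " a "⟫" =>
  {b : Site 2 | a ∈ B ∧ b ∈ B ∧ ∃ d : Fin 2,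
    (b = a + Pi.single d 1 ∧ (a, d) ∈ U) ∨ (a = b + Pi.single d 1 ∧ (b, d) ∈ U)}

/-- The open cluster of `a` inside `B`. -/
local notation "clus⟪" B ", " U ", " a "⟫" =>
  {b : Site 2 | Relation.ReflTransGen (fun x y : Site 2 => y ∈ nbr⟪B, U, x⟫) a b}

/-- The vertices joined inside `B` to the side `L`. -/
local notation "side⟪" B ", " U ", " L "⟫" => {v : Site 2 | ∃ a ∈ L, v ∈ clus⟪B, U, a⟫}

/-- The label configurations joining `L` to `R` inside `B`. -/
local notation "joined⟪" B ", " L ", " R "⟫" =>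
  {U : Set (Site 2 × Fin 2) | ∃ a ∈ L, ∃ b ∈ R, b ∈ clus⟪B, U, a⟫}

/-- The box. -/
local notation "Bx" => (KST2023.box M N)

/-- Its left side. -/
local notation "Lx" => {x : Site 2 | x ∈ KST2023.box M N ∧ x 0 = -(M : ℤ)}

/-- Its right side. -/
local notation "Rx" => {x : Site 2 | x ∈ KST2023.box M N ∧ x 0 = (M : ℤ)}

/-- Crossing of the box by a label configuration. -/
local notation "Cr⟪" V "⟫" => (edgeConfig V ∈ KST2023.crossing M N)

/-! ### Adjacencies with computed offsets -/

/-- Forward along `d`. -/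
theorem adj_d (hd : d' ≠ d) {U : Set (Site 2 × Fin 2)} {α α' β : ℤ} (h : α' = α + 1) (h1 : pt⟪α, β⟫ ∈ Bx)
    (h2 : pt⟪α', β⟫ ∈ Bx) (hU : (pt⟪α, β⟫, d) ∈ U) : pt⟪α', β⟫ ∈ nbr⟪Bx, U, pt⟪α, β⟫⟫ := by
  subst h; exact nbr_single_d hd h1 h2 hU

/-- Backward along `d`. -/
theorem adj_d_back (hd : d' ≠ d) {U : Set (Site 2 × Fin 2)} {α α' β : ℤ} (h : α' = α + 1)
    (h1 : pt⟪α', β⟫ ∈ Bx) (h2 : pt⟪α, β⟫ ∈ Bx) (hU : (pt⟪α, β⟫, d) ∈ U) : pt⟪α, β⟫ ∈ nbr⟪Bx, U, pt⟪α', β⟫⟫ := by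
  subst h; exact nbr_single_d_back hd h1 h2 hU

/-- Forward along `d'`. -/
theorem adj_d' (hd : d' ≠ d) {U : Set (Site 2 × Fin 2)} {α β β' : ℤ} (h : β' = β + 1) (h1 : pt⟪α, β⟫ ∈ Bx)
    (h2 : pt⟪α, β'⟫ ∈ Bx) (hU : (pt⟪α, β⟫, d') ∈ U) : pt⟪α, β'⟫ ∈ nbr⟪Bx, U, pt⟪α, β⟫⟫ := by
  subst h; exact nbr_single_d' hd h1 h2 hU

/-- Backward along `d'`. -/
theorem adj_d'_back (hd : d' ≠ d) {U : Set (Site 2 × Fin 2)} {α β β' : ℤ} (h : β' = β + 1)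
    (h1 : pt⟪α, β'⟫ ∈ Bx) (h2 : pt⟪α, β⟫ ∈ Bx) (hU : (pt⟪α, β⟫, d') ∈ U) : pt⟪α, β⟫ ∈ nbr⟪Bx, U, pt⟪α, β'⟫⟫ := by
  subst h; exact nbr_single_d'_back hd h1 h2 hU

/-- The vertical step between the tuple row and the row `s = 2t + 1`, at abscissa `α`: from
`pt⟪α, s⟫` back to `pt⟪α, 0⟫` through the label `(pt⟪α, t⟫, d')`. -/
theorem adj_row_to_tuple (hd : d' ≠ d) {α s t : ℤ} (ht : t = 0 ∨ t = -1) (hs : s = 2 * t + 1)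
    (h0 : pt⟪α, 0⟫ ∈ Bx) (h1 : pt⟪α, s⟫ ∈ Bx) :
    pt⟪α, 0⟫ ∈ nbr⟪Bx, ({(pt⟪α, t⟫, d')} : Set (Site 2 × Fin 2)), pt⟪α, s⟫⟫ := by
  rcases ht with rfl | rfl
  · obtain rfl : s = 1 := by omega
    exact adj_d'_back hd (by norm_num) h1 h0 (Set.mem_singleton _)
  · obtain rfl : s = -1 := by omega
    exact adj_d' hd (by norm_num) h1 h0 (Set.mem_singleton _)

/-- The same step in the other direction: from `pt⟪α, 0⟫` to `pt⟪α, s⟫`. -/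
theorem adj_tuple_to_row (hd : d' ≠ d) {α s t : ℤ} (ht : t = 0 ∨ t = -1) (hs : s = 2 * t + 1)
    (h0 : pt⟪α, 0⟫ ∈ Bx) (h1 : pt⟪α, s⟫ ∈ Bx) :
    pt⟪α, s⟫ ∈ nbr⟪Bx, ({(pt⟪α, t⟫, d')} : Set (Site 2 × Fin 2)), pt⟪α, 0⟫⟫ :=
  nbr_symm (adj_row_to_tuple hd ht hs h0 h1)

/-! ### The walks -/

/-- Walk of two labels from the port `pt⟪0, s⟫` of `u` to `m₁`. -/
theorem walk_u2 (hd : d' ≠ d) {V : Set (Site 2 × Fin 2)} {L' R' : Set (Site 2)} {s t : ℤ}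
    (ht : t = 0 ∨ t = -1) (hs : s = 2 * t + 1) (hno : V ∉ joined⟪Bx, L', R'⟫)
    (hp : pt⟪0, s⟫ ∈ side⟪Bx, V, L'⟫) (hpB : pt⟪0, s⟫ ∈ Bx) (hm : pt⟪1, 0⟫ ∈ side⟪Bx, V, R'⟫)
    (hm1B : pt⟪1, 0⟫ ∈ Bx) :
    (V ∉ joined⟪Bx, L', R'⟫ ∧ V ∪ {(pt⟪0, s⟫, d)} ∈ joined⟪Bx, L', R'⟫) ∨
      (V ∪ {(pt⟪0, s⟫, d)} ∉ joined⟪Bx, L', R'⟫ ∧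
        V ∪ {(pt⟪0, s⟫, d)} ∪ {(pt⟪1, t⟫, d')} ∈ joined⟪Bx, L', R'⟫) := by
  have h1B : pt⟪1, s⟫ ∈ Bx := pt_mem_box_mix hd hm1B hpB
  exact surgery₂ (adj_d hd (by norm_num) hpB h1B (Set.mem_singleton _)) (adj_row_to_tuple hd ht hs hm1B h1B)
    hno hp hm

/-- Walk of four labels from the port `pt⟪-1, 0⟫` of `u` to `m₁` along the row `s`. -/
theorem walk_u4 (hd : d' ≠ d) {V : Set (Site 2 × Fin 2)} {L' R' : Set (Site 2)} {s t : ℤ}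
    (ht : t = 0 ∨ t = -1) (hs : s = 2 * t + 1) (hno : V ∉ joined⟪Bx, L', R'⟫)
    (hp : pt⟪-1, 0⟫ ∈ side⟪Bx, V, L'⟫) (hpB : pt⟪-1, 0⟫ ∈ Bx) (hsB : pt⟪0, s⟫ ∈ Bx)
    (hm : pt⟪1, 0⟫ ∈ side⟪Bx, V, R'⟫) (hm1B : pt⟪1, 0⟫ ∈ Bx) :
    (V ∉ joined⟪Bx, L', R'⟫ ∧ V ∪ {(pt⟪-1, t⟫, d')} ∈ joined⟪Bx, L', R'⟫) ∨
      (V ∪ {(pt⟪-1, t⟫, d')} ∉ joined⟪Bx, L', R'⟫ ∧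
        V ∪ {(pt⟪-1, t⟫, d')} ∪ {(pt⟪-1, s⟫, d)} ∈ joined⟪Bx, L', R'⟫) ∨
      (V ∪ {(pt⟪-1, t⟫, d')} ∪ {(pt⟪-1, s⟫, d)} ∉ joined⟪Bx, L', R'⟫ ∧
        V ∪ {(pt⟪-1, t⟫, d')} ∪ {(pt⟪-1, s⟫, d)} ∪ {(pt⟪0, s⟫, d)} ∈ joined⟪Bx, L', R'⟫) ∨
      (V ∪ {(pt⟪-1, t⟫, d')} ∪ {(pt⟪-1, s⟫, d)} ∪ {(pt⟪0, s⟫, d)} ∉ joined⟪Bx, L', R'⟫ ∧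
        V ∪ {(pt⟪-1, t⟫, d')} ∪ {(pt⟪-1, s⟫, d)} ∪ {(pt⟪0, s⟫, d)} ∪ {(pt⟪1, t⟫, d')} ∈
          joined⟪Bx, L', R'⟫) := by
  have hm1s : pt⟪-1, s⟫ ∈ Bx := pt_mem_box_mix hd hpB hsB
  have h1s : pt⟪1, s⟫ ∈ Bx := pt_mem_box_mix hd hm1B hsB
  exact surgery₄ (adj_tuple_to_row hd ht hs hpB hm1s) (adj_d hd (by norm_num) hm1s hsB (Set.mem_singleton _))
    (adj_d hd (by norm_num) hsB h1s (Set.mem_singleton _)) (adj_row_to_tuple hd ht hs hm1B h1s) hno hp hm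

/-- Walk of two labels from the port `pt⟪3, s⟫` of `w` to `m₂`. -/
theorem walk_w2 (hd : d' ≠ d) {V : Set (Site 2 × Fin 2)} {L' R' : Set (Site 2)} {s t : ℤ}
    (ht : t = 0 ∨ t = -1) (hs : s = 2 * t + 1) (hno : V ∉ joined⟪Bx, L', R'⟫)
    (hp : pt⟪3, s⟫ ∈ side⟪Bx, V, L'⟫) (hpB : pt⟪3, s⟫ ∈ Bx) (hm : pt⟪2, 0⟫ ∈ side⟪Bx, V, R'⟫)
    (hm2B : pt⟪2, 0⟫ ∈ Bx) :
    (V ∉ joined⟪Bx, L', R'⟫ ∧ V ∪ {(pt⟪2, s⟫, d)} ∈ joined⟪Bx, L', R'⟫) ∨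
      (V ∪ {(pt⟪2, s⟫, d)} ∉ joined⟪Bx, L', R'⟫ ∧
        V ∪ {(pt⟪2, s⟫, d)} ∪ {(pt⟪2, t⟫, d')} ∈ joined⟪Bx, L', R'⟫) := by
  have h2s : pt⟪2, s⟫ ∈ Bx := pt_mem_box_mix hd hm2B hpB
  exact surgery₂ (adj_d_back hd (by norm_num) hpB h2s (Set.mem_singleton _)) (adj_row_to_tuple hd ht hs hm2B h2s)
    hno hp hm

/-- Walk of four labels from the port `pt⟪4, 0⟫` of `w` to `m₂` along the row `s`. -/
theorem walk_w4 (hd : d' ≠ d) {V : Set (Site 2 × Fin 2)} {L' R' : Set (Site 2)} {s t : ℤ}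
    (ht : t = 0 ∨ t = -1) (hs : s = 2 * t + 1) (hno : V ∉ joined⟪Bx, L', R'⟫)
    (hp : pt⟪4, 0⟫ ∈ side⟪Bx, V, L'⟫) (hpB : pt⟪4, 0⟫ ∈ Bx) (hsB : pt⟪0, s⟫ ∈ Bx)
    (hm : pt⟪2, 0⟫ ∈ side⟪Bx, V, R'⟫) (hm2B : pt⟪2, 0⟫ ∈ Bx) (hwB : pt⟪3, 0⟫ ∈ Bx) :
    (V ∉ joined⟪Bx, L', R'⟫ ∧ V ∪ {(pt⟪4, t⟫, d')} ∈ joined⟪Bx, L', R'⟫) ∨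
      (V ∪ {(pt⟪4, t⟫, d')} ∉ joined⟪Bx, L', R'⟫ ∧
        V ∪ {(pt⟪4, t⟫, d')} ∪ {(pt⟪3, s⟫, d)} ∈ joined⟪Bx, L', R'⟫) ∨
      (V ∪ {(pt⟪4, t⟫, d')} ∪ {(pt⟪3, s⟫, d)} ∉ joined⟪Bx, L', R'⟫ ∧
        V ∪ {(pt⟪4, t⟫, d')} ∪ {(pt⟪3, s⟫, d)} ∪ {(pt⟪2, s⟫, d)} ∈ joined⟪Bx, L', R'⟫) ∨
      (V ∪ {(pt⟪4, t⟫, d')} ∪ {(pt⟪3, s⟫, d)} ∪ {(pt⟪2, s⟫, d)} ∉ joined⟪Bx, L', R'⟫ ∧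
        V ∪ {(pt⟪4, t⟫, d')} ∪ {(pt⟪3, s⟫, d)} ∪ {(pt⟪2, s⟫, d)} ∪ {(pt⟪2, t⟫, d')} ∈
          joined⟪Bx, L', R'⟫) := by
  have h4s : pt⟪4, s⟫ ∈ Bx := pt_mem_box_mix hd hpB hsB
  have h3s : pt⟪3, s⟫ ∈ Bx := pt_mem_box_mix hd hwB hsB
  have h2s : pt⟪2, s⟫ ∈ Bx := pt_mem_box_mix hd hm2B hsB
  exact surgery₄ (adj_tuple_to_row hd ht hs hpB h4s) (adj_d_back hd (by norm_num) h4s h3s (Set.mem_singleton _))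
    (adj_d_back hd (by norm_num) h3s h2s (Set.mem_singleton _)) (adj_row_to_tuple hd ht hs hm2B h2s) hno hp hm

/-- Walk of three labels from `m₁` to `m₂` along the row `s`. -/
theorem walk_m3 (hd : d' ≠ d) {V : Set (Site 2 × Fin 2)} {L' R' : Set (Site 2)} {s t : ℤ}
    (ht : t = 0 ∨ t = -1) (hs : s = 2 * t + 1) (hno : V ∉ joined⟪Bx, L', R'⟫)
    (hp : pt⟪1, 0⟫ ∈ side⟪Bx, V, L'⟫) (hm1B : pt⟪1, 0⟫ ∈ Bx) (hsB : pt⟪0, s⟫ ∈ Bx)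
    (hm : pt⟪2, 0⟫ ∈ side⟪Bx, V, R'⟫) (hm2B : pt⟪2, 0⟫ ∈ Bx) :
    (V ∉ joined⟪Bx, L', R'⟫ ∧ V ∪ {(pt⟪1, t⟫, d')} ∈ joined⟪Bx, L', R'⟫) ∨
      (V ∪ {(pt⟪1, t⟫, d')} ∉ joined⟪Bx, L', R'⟫ ∧
        V ∪ {(pt⟪1, t⟫, d')} ∪ {(pt⟪1, s⟫, d)} ∈ joined⟪Bx, L', R'⟫) ∨
      (V ∪ {(pt⟪1, t⟫, d')} ∪ {(pt⟪1, s⟫, d)} ∉ joined⟪Bx, L', R'⟫ ∧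
        V ∪ {(pt⟪1, t⟫, d')} ∪ {(pt⟪1, s⟫, d)} ∪ {(pt⟪2, t⟫, d')} ∈ joined⟪Bx, L', R'⟫) := by
  have h1s : pt⟪1, s⟫ ∈ Bx := pt_mem_box_mix hd hm1B hsB
  have h2s : pt⟪2, s⟫ ∈ Bx := pt_mem_box_mix hd hm2B hsB
  exact surgery₃ (adj_tuple_to_row hd ht hs hm1B h1s) (adj_d hd (by norm_num) h1s h2s (Set.mem_singleton _))
    (adj_row_to_tuple hd ht hs hm2B h2s) hno hp hm

/-! ### The atoms -/

/-- A row next to the tuple, as `s = 2t + 1`. -/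
theorem exists_row (hrow : pt⟪0, 1⟫ ∈ Bx ∨ pt⟪0, -1⟫ ∈ Bx) :
    ∃ t s : ℤ, (t = 0 ∨ t = -1) ∧ s = 2 * t + 1 ∧ pt⟪0, s⟫ ∈ Bx := by
  rcases hrow with h | h
  · exact ⟨0, 1, Or.inl rfl, by norm_num, h⟩
  · exact ⟨-1, -1, Or.inr rfl, by norm_num, h⟩

/-- **Atom at `u`, generic sides.** -/
theorem atom_u_aux (hd : d' ≠ d) {V : Set (Site 2 × Fin 2)} {L' R' : Set (Site 2)}
    (P : Set (Site 2 × Fin 2) → Prop) (hP : ∀ U, P U ↔ U ∈ joined⟪Bx, L', R'⟫)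
    (hT0 : (pt⟪0, 0⟫, d) ∉ V) (hbox : ∀ j : ℤ, 0 ≤ j → j ≤ 3 → pt⟪j, 0⟫ ∈ Bx)
    (hrow : pt⟪0, 1⟫ ∈ Bx ∨ pt⟪0, -1⟫ ∈ Bx)
    (huL' : pt⟪0, 0⟫ ∈ L' → ∀ s : ℤ, (s = 1 ∨ s = -1) → pt⟪0, s⟫ ∈ Bx → pt⟪0, s⟫ ∈ L')
    (hno : V ∉ joined⟪Bx, L', R'⟫) (hu : pt⟪0, 0⟫ ∈ side⟪Bx, V, L'⟫) (hm : pt⟪1, 0⟫ ∈ side⟪Bx, V, R'⟫) :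
    ∃ t s : ℤ, (t = 0 ∨ t = -1) ∧ s = 2 * t + 1 ∧
      ((¬ P V ∧ P (V ∪ {(pt⟪0, s⟫, d)})) ∨
        (¬ P (V ∪ {(pt⟪0, s⟫, d)}) ∧ P (V ∪ {(pt⟪0, s⟫, d)} ∪ {(pt⟪1, t⟫, d')})) ∨
        (¬ P V ∧ P (V ∪ {(pt⟪-1, t⟫, d')})) ∨
        (¬ P (V ∪ {(pt⟪-1, t⟫, d')}) ∧ P (V ∪ {(pt⟪-1, t⟫, d')} ∪ {(pt⟪-1, s⟫, d)})) ∨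
        (¬ P (V ∪ {(pt⟪-1, t⟫, d')} ∪ {(pt⟪-1, s⟫, d)}) ∧
          P (V ∪ {(pt⟪-1, t⟫, d')} ∪ {(pt⟪-1, s⟫, d)} ∪ {(pt⟪0, s⟫, d)})) ∨
        (¬ P (V ∪ {(pt⟪-1, t⟫, d')} ∪ {(pt⟪-1, s⟫, d)} ∪ {(pt⟪0, s⟫, d)}) ∧
          P (V ∪ {(pt⟪-1, t⟫, d')} ∪ {(pt⟪-1, s⟫, d)} ∪ {(pt⟪0, s⟫, d)} ∪ {(pt⟪1, t⟫, d')}))) := by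
  have hm1B := hbox 1 (by norm_num) (by norm_num)
  simp only [hP]
  -- the two-label walk from a port `pt⟪0, s⟫`
  have two : ∀ {t s : ℤ}, (t = 0 ∨ t = -1) → s = 2 * t + 1 → pt⟪0, s⟫ ∈ side⟪Bx, V, L'⟫ → pt⟪0, s⟫ ∈ Bx →
      ∃ t s : ℤ, (t = 0 ∨ t = -1) ∧ s = 2 * t + 1 ∧
      ((V ∉ joined⟪Bx, L', R'⟫ ∧ V ∪ {(pt⟪0, s⟫, d)} ∈ joined⟪Bx, L', R'⟫) ∨
        (V ∪ {(pt⟪0, s⟫, d)} ∉ joined⟪Bx, L', R'⟫ ∧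
          V ∪ {(pt⟪0, s⟫, d)} ∪ {(pt⟪1, t⟫, d')} ∈ joined⟪Bx, L', R'⟫) ∨
        (V ∉ joined⟪Bx, L', R'⟫ ∧ V ∪ {(pt⟪-1, t⟫, d')} ∈ joined⟪Bx, L', R'⟫) ∨
        (V ∪ {(pt⟪-1, t⟫, d')} ∉ joined⟪Bx, L', R'⟫ ∧
          V ∪ {(pt⟪-1, t⟫, d')} ∪ {(pt⟪-1, s⟫, d)} ∈ joined⟪Bx, L', R'⟫) ∨
        (V ∪ {(pt⟪-1, t⟫, d')} ∪ {(pt⟪-1, s⟫, d)} ∉ joined⟪Bx, L', R'⟫ ∧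
          V ∪ {(pt⟪-1, t⟫, d')} ∪ {(pt⟪-1, s⟫, d)} ∪ {(pt⟪0, s⟫, d)} ∈ joined⟪Bx, L', R'⟫) ∨
        (V ∪ {(pt⟪-1, t⟫, d')} ∪ {(pt⟪-1, s⟫, d)} ∪ {(pt⟪0, s⟫, d)} ∉ joined⟪Bx, L', R'⟫ ∧
          V ∪ {(pt⟪-1, t⟫, d')} ∪ {(pt⟪-1, s⟫, d)} ∪ {(pt⟪0, s⟫, d)} ∪ {(pt⟪1, t⟫, d')} ∈
            joined⟪Bx, L', R'⟫)) := by
    intro t s ht hs hp hpB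
    refine ⟨t, s, ht, hs, ?_⟩
    rcases walk_u2 hd ht hs hno hp hpB hm hm1B with h | h
    · exact Or.inl h
    · exact Or.inr (Or.inl h)
  rcases side_cases hu with huL | ⟨p, hp, hpu⟩
  · -- `u` lies on the side: its port on the row `s` lies on the side too
    obtain ⟨t, s, ht, hs, hsB⟩ := exists_row hrow
    exact two ht hs (mem_side_of_mem (huL' huL s (by omega) hsB)) hsB
  · have hpu' := nbr_symm hpu
    have hpB : p ∈ Bx := hpu'.2.1
    rcases nbr_pt hd hpu' with ⟨h, -⟩ | ⟨-, rfl⟩ | ⟨-, rfl⟩ | ⟨-, rfl⟩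
    · exact absurd h hT0
    · -- port `pt⟪-1, 0⟫`: the four-label walk
      simp only [show (0 : ℤ) - 1 = -1 by norm_num] at hp hpB
      obtain ⟨t, s, ht, hs, hsB⟩ := exists_row hrow
      refine ⟨t, s, ht, hs, ?_⟩
      rcases walk_u4 hd ht hs hno hp hpB hsB hm hm1B with h | h | h | h
      · exact Or.inr (Or.inr (Or.inl h))
      · exact Or.inr (Or.inr (Or.inr (Or.inl h)))
      · exact Or.inr (Or.inr (Or.inr (Or.inr (Or.inl h))))
      · exact Or.inr (Or.inr (Or.inr (Or.inr (Or.inr h))))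
    · simp only [show (0 : ℤ) + 1 = 1 by norm_num] at hp hpB
      exact two (t := 0) (Or.inl rfl) (by norm_num) hp hpB
    · simp only [show (0 : ℤ) - 1 = -1 by norm_num] at hp hpB
      exact two (t := -1) (Or.inr rfl) (by norm_num) hp hpB

/-- **Atom at `u`.** If the tuple is closed in `V`, the sides of the box are not joined by `V` but
are joined by `V ∪ {first sub-edge}`, then along one of the two walks next to `u` some interior
label becomes pivotal after opening the previous labels of the walk. -/
theorem atom_u (hd : d' ≠ d) {V : Set (Site 2 × Fin 2)} (hT0 : (pt⟪0, 0⟫, d) ∉ V)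
    (hbox : ∀ j : ℤ, 0 ≤ j → j ≤ 3 → pt⟪j, 0⟫ ∈ Bx) (hrow : pt⟪0, 1⟫ ∈ Bx ∨ pt⟪0, -1⟫ ∈ Bx)
    (huR : pt⟪0, 0⟫ ∉ Rx)
    (huL : pt⟪0, 0⟫ ∈ Lx → ∀ s : ℤ, (s = 1 ∨ s = -1) → pt⟪0, s⟫ ∈ Bx → pt⟪0, s⟫ ∈ Lx)
    (hno : ¬ Cr⟪V⟫) (hyes : Cr⟪V ∪ {(pt⟪0, 0⟫, d)}⟫) :
    ∃ t s : ℤ, (t = 0 ∨ t = -1) ∧ s = 2 * t + 1 ∧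
      ((¬ Cr⟪V⟫ ∧ Cr⟪V ∪ {(pt⟪0, s⟫, d)}⟫) ∨
        (¬ Cr⟪V ∪ {(pt⟪0, s⟫, d)}⟫ ∧ Cr⟪V ∪ {(pt⟪0, s⟫, d)} ∪ {(pt⟪1, t⟫, d')}⟫) ∨
        (¬ Cr⟪V⟫ ∧ Cr⟪V ∪ {(pt⟪-1, t⟫, d')}⟫) ∨
        (¬ Cr⟪V ∪ {(pt⟪-1, t⟫, d')}⟫ ∧ Cr⟪V ∪ {(pt⟪-1, t⟫, d')} ∪ {(pt⟪-1, s⟫, d)}⟫) ∨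
        (¬ Cr⟪V ∪ {(pt⟪-1, t⟫, d')} ∪ {(pt⟪-1, s⟫, d)}⟫ ∧
          Cr⟪V ∪ {(pt⟪-1, t⟫, d')} ∪ {(pt⟪-1, s⟫, d)} ∪ {(pt⟪0, s⟫, d)}⟫) ∨
        (¬ Cr⟪V ∪ {(pt⟪-1, t⟫, d')} ∪ {(pt⟪-1, s⟫, d)} ∪ {(pt⟪0, s⟫, d)}⟫ ∧
          Cr⟪V ∪ {(pt⟪-1, t⟫, d')} ∪ {(pt⟪-1, s⟫, d)} ∪ {(pt⟪0, s⟫, d)} ∪ {(pt⟪1, t⟫, d')}⟫)) := by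
  have hP : ∀ U : Set (Site 2 × Fin 2), Cr⟪U⟫ ↔ U ∈ joined⟪Bx, Lx, Rx⟫ :=
    fun U => edgeConfig_mem_crossing_iff U M N
  have hP' : ∀ U : Set (Site 2 × Fin 2), Cr⟪U⟫ ↔ U ∈ joined⟪Bx, Rx, Lx⟫ :=
    fun U => (hP U).trans ⟨joined_symm, joined_symm⟩
  have hadj : pt⟪1, 0⟫ ∈ nbr⟪Bx, ({(pt⟪0, 0⟫, d)} : Set (Site 2 × Fin 2)), pt⟪0, 0⟫⟫ :=
    adj_d hd (by norm_num) (hbox 0 le_rfl (by norm_num)) (hbox 1 (by norm_num) (by norm_num)) (Set.mem_singleton _)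
  rcases add_edge hadj ((hP V).not.1 hno) ((hP _).1 hyes) with ⟨huL', hmR⟩ | ⟨hmL, huR'⟩
  · exact atom_u_aux hd (fun U => Cr⟪U⟫) hP hT0 hbox hrow huL ((hP V).not.1 hno) huL' hmR
  · exact atom_u_aux hd (fun U => Cr⟪U⟫) hP' hT0 hbox hrow (fun h => absurd h huR)
      ((hP' V).not.1 hno) huR' hmL

end Cone3

/-- **Registered sub-goal `stub_cone3_localC` of stub `stub_cone3`** (`Cone3.exists_row` with all local notations
expanded). -/
theorem stub_cone3_localC : ∀ {M N : ℕ} {b : Site 2} {d d' : Fin 2} (hrow : ((3 : ℤ) • b + (0 : ℤ) • (Pi.single d (1 : ℤ) : Site 2) + (1 : ℤ) • (Pi.single d' (1 : ℤ) : Site 2)) ∈ (KST2023.box M N) ∨ ((3 : ℤ) • b + (0 : ℤ) • (Pi.single d (1 : ℤ) : Site 2) + (-1 : ℤ) • (Pi.single d' (1 : ℤ) : Site 2)) ∈ (KST2023.box M N)), ∃ t s : ℤ, (t = 0 ∨ t = -1) ∧ s = 2 * t + 1 ∧ ((3 : ℤ) • b + (0 : ℤ) • (Pi.single d (1 : ℤ)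 : Site 2) + (s : ℤ) • (Pi.single d' (1 : ℤ) : Site 2)) ∈ (KST2023.box M N) := by
  intro M N b d d' hrow
  exact Cone3.exists_row hrow

end Summit.CriticalPhenomena.CardyFormulaZ2.Cruxes.CriticalPathRSW.FiniteSizeEnvelope

end
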